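import Summits.Parity.GeneralizedHardyLittlewood.Theorems.BeyondDiagonalBeatsQuarter.OffDiagPrincipalShort
import Literature.NumberTheory.Sieve.MontgomeryVaughan1975GaussSums
import Mathlib.NumberTheory.ArithmeticFunction.Moebius
import Mathlib.RingTheory.Coprime.Lemmas
import HarnessLib

/-!
# Route `PrimeLevelFamEdge`, crux K_B (stmt-Parity-20343), line `diagonal_kernel_split` rev 4, plan Ω,
# KEYS-NEXT S3/S4 follow-up (OMEGA-BLUEPRINT L6′/a8P) — **the principal part of the class count is a
# COPRIME-RESTRICTED shifted-lattice sum: one `s`-stratum only (`gcd(s,h₁) = gcd(ab,h₁)`), Möbius inversion of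
# `(s′, n₀) = 1`, Poisson per sublattice; for TALL moduli the principal part does NOT vanish (E14 is the `e = 1` term)**

After the divisor switch (`OffDiagBlockSwitch`) and the strata identification (`OffDiagBlockStrata`), for a fixed unit
dual modulus `h₁` (`(h₁, c) = 1`) and frequencies `a, b` the levels `q` coprime to `h₁` with `h₁ ∣ ab + q·c·s` exist only
for `s` in ONE stratum: `gcd(s, h₁) = g₀ := gcd(ab, h₁)` (§1). Hence the `s`-sum of the principal parts
(`OffDiagLevelAP.levelPrincipal`, modulus `n₀ = |h₁|/g₀`) runs over `s = g₀s′` with `(s′, n₀) = 1` — a coprime-restricted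
lattice, NOT the complete lattice of `OffDiagPrincipalBlock` (E14). This file supplies the exact evaluation:

* §1 `intGcd_eq_intGcd_of_dvd_switch` — `(u, n) = 1`, `n ∣ A + u·s` ⟹ `gcd(s, n) = gcd(A, n)`;
* §2 `ite_isCoprime_eq_sum_divisors` (with `MontgomeryVaughan1975.sum_divisors_moebius_eq`), **`tsum_ite_isCoprime_eq_sum_moebius`** — Möbius
  inversion of the coprimality on a `ℤ`-indexed series: `Σ'_{s} 𝟙[(s,n)=1]·f s = Σ_{e∣n} μ(e)·Σ'_{t} f(e·t)` (`f` summable);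
* §3 **`tsum_coprime_fourier2_intShift_eq`** — for `uncurry Φ` smooth of compact support, `h ≠ 0`:
  `Σ'_{(s,h)=1} Φ̂(ξ₁, s/h + τ) = Σ_{e ∣ |h|} μ(e)·(|h|/e)·Σ'_{k} e(−τ(|h|/e)k)·𝓕(t₁ ↦ Φ(t₁,(|h|/e)k))(ξ₁)`
  (each sublattice `eℤ` is a complete shifted lattice of modulus `h/e`: `tsum_fourier2_intShift_eq`); in Ramanujan-sum
  form the height-`m` coefficient is `c_{|h|}(m)` (Kluyver) — NOT here;
* §4 `tsum_sublattice_samples_eq_zero_of_le`, **`tsum_coprime_fourier2_intShift_eq_sum_filter`**, `…_eq_sum_Icc` — with the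
  box support `Φ ≠ 0 ⇒ B₀ < t₂ < B` (`0 ≤ B₀`): the divisors with `|h|/e ≥ B` drop out and the rest are FINITE `k`-sums
  (`OffDiagPrincipalShort.tsum_latticeSamples_eq_sum_Icc`); for a TALL modulus `|h| ≥ B` the `e = 1` term is absent
  (this is E14 `principalBlock_eq_zero_of_height_le`) but every `e ∣ |h|` with `|h|/e < B` samples the box;
* §5 **`tsum_coprime_levelPrincipal_eq`** — the same after the density factor `φ(n)⁻¹` and the finite level sum
  (`OffDiagLevelAP.levelPrincipal`), the shape `OffDiagCoreSplit`'s `coreP` has once empty classes are routed to `0`.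

Consequence recorded for the planner (not a kernel statement): a8P has a TALL-moduli row (Ramanujan coefficients
`c_{n₀}(m)/φ(n₀)`), of the same order per modulus as a short-modulus term; «long-moduli principal part = 0» holds for
the complete-lattice object only. Identities only; theorems only; standard axioms. Helper toward
`stub_offDiagBelowSlack_io`; closes nothing.
«The programme SEARCHES and TYPES; no claim about Landau–Siegel zeros, Theorems 1–2 of arXiv:2211.02515 or
a repaired Margin232 until a kernel theorem says so.»
-/

noncomputable section

open Real MeasureTheory Filter Complex Finset
open scoped FourierTransform Topology ContDiff ArithmeticFunction.Moebius

namespace Summit.Parity.GeneralizedHardyLittlewood.Theorems.BeyondDiagonalBeatsQuarter.OffDiag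

open Literature.NumberTheory.Sieve.FriedlanderIwaniecPrimes

/-! ### §1. One `s`-stratum only -/

/-- **The switched variable lies in one stratum.** For integers `n` (the dual modulus `h₁`), `A` (`= ab`), `u`
(`= q·c`) with `(u, n) = 1`, and `s`: if `n ∣ A + u·s` then `gcd(s, n) = gcd(A, n)`. So for fixed `(h₁, a, b)` the
levels coprime to `h₁` occur only for `s` with `gcd(s, h₁) = gcd(ab, h₁)`. [folklore] -/
theorem intGcd_eq_intGcd_of_dvd_switch {n A u s : ℤ} (hu : IsCoprime u n) (hd : n ∣ A + u * s) :
    Int.gcd s n = Int.gcd A n := by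
  apply Nat.dvd_antisymm
  · -- `gcd(s,n) ∣ A`
    have h1 : ((Int.gcd s n : ℕ) : ℤ) ∣ A := by
      have ha : ((Int.gcd s n : ℕ) : ℤ) ∣ A + u * s := dvd_trans (Int.gcd_dvd_right s n) hd
      have hb : ((Int.gcd s n : ℕ) : ℤ) ∣ u * s := dvd_mul_of_dvd_right (Int.gcd_dvd_left s n) u
      exact (dvd_add_left hb).mp ha
    exact Int.dvd_gcd h1 (Int.gcd_dvd_right s n)
  · -- `gcd(A,n) ∣ s` since it divides `u·s` and is coprime to `u`
    have h2 : ((Int.gcd A n : ℕ) : ℤ) ∣ u * s :=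
      (dvd_add_right (Int.gcd_dvd_left A n)).mp (dvd_trans (Int.gcd_dvd_right A n) hd)
    have hcop : IsCoprime ((Int.gcd A n : ℕ) : ℤ) u :=
      (hu.symm.of_isCoprime_of_dvd_left (Int.gcd_dvd_right A n))
    have h3 : ((Int.gcd A n : ℕ) : ℤ) ∣ s := hcop.dvd_of_dvd_mul_left h2
    exact Int.dvd_gcd h3 (Int.gcd_dvd_right A n)

/-! ### §2. Möbius inversion of the coprimality on a `ℤ`-indexed series -/

/-- The divisors of `n ≥ 1` dividing `s` are the divisors of `gcd(s, n)`. [folklore] -/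
theorem filter_divisors_dvd_eq {n : ℕ} (hn : 0 < n) (s : ℤ) :
    n.divisors.filter (fun e : ℕ ↦ (e : ℤ) ∣ s) = (Int.gcd s n).divisors := by
  ext e
  simp only [Finset.mem_filter, Nat.mem_divisors, Int.natCast_dvd, Int.gcd_eq_natAbs, Int.natAbs_natCast,
    Nat.dvd_gcd_iff]
  constructor
  · rintro ⟨⟨hen, -⟩, hes⟩
    exact ⟨⟨hes, hen⟩, Nat.gcd_ne_zero_right hn.ne'⟩
  · rintro ⟨⟨hes, hen⟩, -⟩
    exact ⟨⟨hen, hn.ne'⟩, hes⟩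

/-- **The coprimality indicator as a divisor sum**: for `n ≥ 1`,
`𝟙[(s, n) = 1] = Σ_{e ∣ n} 𝟙[e ∣ s]·μ(e)`. [folklore] -/
theorem ite_isCoprime_eq_sum_divisors {n : ℕ} (hn : 0 < n) (s : ℤ) :
    (if IsCoprime s (n : ℤ) then (1 : ℂ) else 0) =
      ∑ e ∈ n.divisors, (if (e : ℤ) ∣ s then (μ e : ℂ) else 0) := by
  rw [← Finset.sum_filter, filter_divisors_dvd_eq hn s,
    Literature.NumberTheory.Sieve.MontgomeryVaughan1975.sum_divisors_moebius_eq]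
  by_cases hc : IsCoprime s (n : ℤ)
  · rw [if_pos hc, if_pos (Int.isCoprime_iff_gcd_eq_one.mp hc)]
  · rw [if_neg hc, if_neg (fun h ↦ hc (Int.isCoprime_iff_gcd_eq_one.mpr h))]

/-- A sublattice series is the restriction of the full series: `Σ'_{s} 𝟙[e ∣ s]·f s = Σ'_{t} f(e·t)` (`e ≠ 0`).
[folklore] -/
theorem tsum_ite_dvd_eq_tsum_mul {e : ℤ} (he : e ≠ 0) (f : ℤ → ℂ) :
    ∑' s : ℤ, (if e ∣ s then f s else 0) = ∑' t : ℤ, f (e * t) := by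
  have hinj : Function.Injective (fun t : ℤ ↦ e * t) := mul_right_injective₀ he
  have h := hinj.tsum_eq (f := fun s : ℤ ↦ if e ∣ s then f s else 0) (by
    intro s hs
    rw [Function.mem_support] at hs
    have hd : e ∣ s := by
      by_contra hnd
      exact hs (if_neg hnd)
    obtain ⟨t, rfl⟩ := hd
    exact ⟨t, rfl⟩)
  rw [← h]
  refine tsum_congr fun t ↦ ?_
  simp only [if_pos (dvd_mul_right e t)]

/-- **Möbius inversion of the coprimality on a series.** For `n ≥ 1` and a summable `f : ℤ → ℂ`:
`Σ'_{s∈ℤ} 𝟙[(s, n) = 1]·f s = Σ_{e ∣ n} μ(e)·Σ'_{t∈ℤ} f(e·t)`. [folklore] -/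
theorem tsum_ite_isCoprime_eq_sum_moebius {n : ℕ} (hn : 0 < n) {f : ℤ → ℂ} (hf : Summable f) :
    ∑' s : ℤ, (if IsCoprime s (n : ℤ) then f s else 0) =
      ∑ e ∈ n.divisors, (μ e : ℂ) * ∑' t : ℤ, f (e * t) := by
  have h1 : ∀ s : ℤ, (if IsCoprime s (n : ℤ) then f s else 0) =
      ∑ e ∈ n.divisors, (if (e : ℤ) ∣ s then (μ e : ℂ) else 0) * f s := by
    intro s
    rw [← Finset.sum_mul, ← ite_isCoprime_eq_sum_divisors hn s]
    split_ifs <;> simp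
  rw [tsum_congr h1, Summable.tsum_finsetSum]
  · refine Finset.sum_congr rfl fun e he ↦ ?_
    have he0 : (e : ℤ) ≠ 0 := by exact_mod_cast Nat.pos_of_mem_divisors he |>.ne'
    have h2 : ∀ s : ℤ, (if (e : ℤ) ∣ s then (μ e : ℂ) else 0) * f s =
        (μ e : ℂ) * (if (e : ℤ) ∣ s then f s else 0) := by
      intro s; split_ifs <;> simp
    rw [tsum_congr h2, tsum_mul_left, tsum_ite_dvd_eq_tsum_mul he0]
  · intro e _
    refine ((hf.mul_left (μ e : ℂ)).indicator {s : ℤ | (e : ℤ) ∣ s}).congr fun s ↦ ?_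
    simp only [Set.indicator_apply, Set.mem_setOf_eq]
    split_ifs <;> simp

/-! ### §3. The coprime-restricted shifted-lattice sum of a box transform -/

section Shift

variable {Φ : ℝ → ℝ → ℂ}

/-- Coprimality to `h` and to `|h|` agree. [folklore] -/
theorem isCoprime_natAbs_iff (s h : ℤ) : IsCoprime s (h.natAbs : ℤ) ↔ IsCoprime s h := by
  rw [Int.isCoprime_iff_gcd_eq_one, Int.isCoprime_iff_gcd_eq_one, Int.gcd_eq_natAbs, Int.gcd_eq_natAbs,
    Int.natAbs_natCast]

/-- A divisor `e` of `|h|` gives the integer `h/e` with `|h/e| = |h|/e`, `h/e ≠ 0`, and `(e·t)/h = t/(h/e)` in `ℝ`.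
[folklore] -/
theorem sublattice_div_facts {h : ℤ} (hh : h ≠ 0) {e : ℕ} (he : e ∈ h.natAbs.divisors) :
    (h / (e : ℤ)) ≠ 0 ∧ (h / (e : ℤ)).natAbs = h.natAbs / e ∧
      ∀ t : ℤ, (((e : ℤ) * t : ℤ) : ℝ) / (h : ℝ) = (t : ℝ) / ((h / (e : ℤ) : ℤ) : ℝ) := by
  have hed : e ∣ h.natAbs := Nat.dvd_of_mem_divisors he
  have he0 : e ≠ 0 := (Nat.pos_of_mem_divisors he).ne'
  have hedZ : (e : ℤ) ∣ h := Int.natCast_dvd.mpr hed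
  obtain ⟨h', hh'⟩ := hedZ
  have he0Z : (e : ℤ) ≠ 0 := by exact_mod_cast he0
  have hdiv : h / (e : ℤ) = h' := by rw [hh', Int.mul_ediv_cancel_left _ he0Z]
  have hh'0 : h' ≠ 0 := by rintro rfl; exact hh (by rw [hh', mul_zero])
  refine ⟨by rwa [hdiv], ?_, fun t ↦ ?_⟩
  · rw [hdiv, hh', Int.natAbs_mul, Int.natAbs_natCast, Nat.mul_div_cancel_left _ (Nat.pos_of_ne_zero he0)]
  · rw [hdiv, hh']
    push_cast
    have he0R : (e : ℝ) ≠ 0 := by exact_mod_cast he0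
    have hh'R : (h' : ℝ) ≠ 0 := by exact_mod_cast hh'0
    field_simp

/-- **Coprime-restricted shifted-lattice sum of the box transform = Möbius sum of complete sublattice sums.**
For `uncurry Φ` smooth of compact support, `h ≠ 0`, `τ, ξ₁ ∈ ℝ`:
`Σ'_{s∈ℤ, (s,h)=1} Φ̂(ξ₁, s/h + τ) = Σ_{e ∣ |h|} μ(e)·(|h|/e)·Σ'_{k∈ℤ} e(−τ·(|h|/e)·k)·𝓕(t₁ ↦ Φ(t₁, (|h|/e)·k))(ξ₁)`.
(Equivalently the height-`m` coefficient is the Ramanujan sum `c_{|h|}(m)` — Kluyver; not used here.) [folklore] -/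
theorem tsum_coprime_fourier2_intShift_eq (hΦ : ContDiff ℝ ∞ (Function.uncurry Φ))
    (hΦc : HasCompactSupport (Function.uncurry Φ)) {h : ℤ} (hh : h ≠ 0) (τ ξ₁ : ℝ) :
    ∑' s : ℤ, (if IsCoprime s h then fourier2 Φ ξ₁ ((s : ℝ) / h + τ) else 0) =
      ∑ e ∈ h.natAbs.divisors, (μ e : ℂ) * (((h.natAbs / e : ℕ) : ℂ) *
        ∑' k : ℤ, (𝐞 (-(τ * ((h.natAbs / e : ℕ) * k))) : ℂ) *
          𝓕 (fun t₁ : ℝ ↦ Φ t₁ ((h.natAbs / e : ℕ) * k)) ξ₁) := by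
  have hpos : 0 < h.natAbs := Int.natAbs_pos.mpr hh
  simp_rw [← isCoprime_natAbs_iff _ h]
  rw [tsum_ite_isCoprime_eq_sum_moebius hpos (summable_fourier2_intShift hΦ hΦc hh τ ξ₁)]
  refine Finset.sum_congr rfl fun e he ↦ ?_
  obtain ⟨hne, habs, hfreq⟩ := sublattice_div_facts hh he
  congr 1
  simp_rw [hfreq]
  rw [tsum_fourier2_intShift_eq hΦ hΦc hne τ ξ₁, habs]

end Shift

/-! ### §4. Box support: the surviving divisors and the finite `k`-ranges -/

section Box

variable {Φ : ℝ → ℝ → ℂ}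

/-- **A sublattice whose step reaches the box height contributes nothing.** If `Φ(t₁,t₂) ≠ 0 ⇒ B₀ < t₂ < B` with
`0 ≤ B₀` and the step `d` satisfies `B ≤ d`, then every sample `𝓕(t₁ ↦ Φ(t₁, d·k))(ξ)` (`k ∈ ℤ`) vanishes. [folklore] -/
theorem tsum_sublattice_samples_eq_zero_of_le {B₀ B : ℝ} (hB₀ : 0 ≤ B₀)
    (hsupp : ∀ t₁ t₂, Φ t₁ t₂ ≠ 0 → B₀ < t₂ ∧ t₂ < B) {d : ℕ} (hd : B ≤ (d : ℝ)) (c : ℤ → ℂ) (ξ : ℝ) :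
    ∑' k : ℤ, c k * 𝓕 (fun t₁ : ℝ ↦ Φ t₁ ((d : ℝ) * k)) ξ = 0 := by
  have hzero : ∀ k : ℤ, 𝓕 (fun t₁ : ℝ ↦ Φ t₁ ((d : ℝ) * k)) ξ = 0 := by
    intro k
    refine fourier_slice_eq_zero_of_not_mem hsupp ?_ ξ
    rintro ⟨h1, h2⟩
    have hd0 : (0 : ℝ) ≤ d := by positivity
    rcases le_or_gt k 0 with hk | hk
    · have hk0 : (k : ℝ) ≤ 0 := by exact_mod_cast hk
      have : (d : ℝ) * k ≤ 0 := mul_nonpos_of_nonneg_of_nonpos hd0 hk0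
      linarith
    · have hk1 : (1 : ℝ) ≤ k := by exact_mod_cast hk
      have : (d : ℝ) * 1 ≤ (d : ℝ) * k := mul_le_mul_of_nonneg_left hk1 hd0
      linarith
  simp [hzero]

/-- **Only the divisors with `|h|/e < B` survive.** Under the box support hypothesis, in
`tsum_coprime_fourier2_intShift_eq` the sum over `e ∣ |h|` may be restricted to `|h|/e < B`; in particular for a
TALL modulus `|h| ≥ B` the term `e = 1` (the complete-lattice term of E14) is absent, the others remain. [folklore] -/
theorem tsum_coprime_fourier2_intShift_eq_sum_filter (hΦ : ContDiff ℝ ∞ (Function.uncurry Φ))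
    (hΦc : HasCompactSupport (Function.uncurry Φ)) {B₀ B : ℝ} (hB₀ : 0 ≤ B₀)
    (hsupp : ∀ t₁ t₂, Φ t₁ t₂ ≠ 0 → B₀ < t₂ ∧ t₂ < B) {h : ℤ} (hh : h ≠ 0) (τ ξ₁ : ℝ) :
    ∑' s : ℤ, (if IsCoprime s h then fourier2 Φ ξ₁ ((s : ℝ) / h + τ) else 0) =
      ∑ e ∈ h.natAbs.divisors.filter (fun e : ℕ ↦ ((h.natAbs / e : ℕ) : ℝ) < B), (μ e : ℂ) *
        (((h.natAbs / e : ℕ) : ℂ) * ∑' k : ℤ, (𝐞 (-(τ * ((h.natAbs / e : ℕ) * k))) : ℂ) *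
          𝓕 (fun t₁ : ℝ ↦ Φ t₁ ((h.natAbs / e : ℕ) * k)) ξ₁) := by
  rw [tsum_coprime_fourier2_intShift_eq hΦ hΦc hh τ ξ₁, Finset.sum_filter]
  refine Finset.sum_congr rfl fun e _ ↦ ?_
  split_ifs with hlt
  · rfl
  · rw [tsum_sublattice_samples_eq_zero_of_le hB₀ hsupp (le_of_not_gt hlt), mul_zero, mul_zero]

/-- **Finite form.** Under the box support hypothesis and `B ≤ N + 1`, every surviving sublattice sum is the finite sum
over `k ∈ [1, N]` (`OffDiagPrincipalShort.tsum_latticeSamples_eq_sum_Icc` with step `|h|/e ≥ 1`). [folklore] -/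
theorem tsum_coprime_fourier2_intShift_eq_sum_Icc (hΦ : ContDiff ℝ ∞ (Function.uncurry Φ))
    (hΦc : HasCompactSupport (Function.uncurry Φ)) {B₀ B : ℝ} (hB₀ : 0 ≤ B₀)
    (hsupp : ∀ t₁ t₂, Φ t₁ t₂ ≠ 0 → B₀ < t₂ ∧ t₂ < B) {h : ℤ} (hh : h ≠ 0) {N : ℕ} (hN : B ≤ (N : ℝ) + 1)
    (τ ξ₁ : ℝ) :
    ∑' s : ℤ, (if IsCoprime s h then fourier2 Φ ξ₁ ((s : ℝ) / h + τ) else 0) =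
      ∑ e ∈ h.natAbs.divisors, (μ e : ℂ) * (((h.natAbs / e : ℕ) : ℂ) *
        ∑ k ∈ Finset.Icc (1 : ℤ) N, (𝐞 (-(τ * ((h.natAbs / e : ℕ) * k))) : ℂ) *
          𝓕 (fun t₁ : ℝ ↦ Φ t₁ ((h.natAbs / e : ℕ) * k)) ξ₁) := by
  rw [tsum_coprime_fourier2_intShift_eq hΦ hΦc hh τ ξ₁]
  refine Finset.sum_congr rfl fun e he ↦ ?_
  have hstep : 0 < h.natAbs / e :=
    Nat.div_pos (Nat.le_of_dvd (Int.natAbs_pos.mpr hh) (Nat.dvd_of_mem_divisors he))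
      (Nat.pos_of_mem_divisors he)
  have hN' : B ≤ ((h.natAbs / e : ℕ) : ℝ) * (N + 1) := by
    have h1 : (1 : ℝ) ≤ (h.natAbs / e : ℕ) := by exact_mod_cast hstep
    have h2 : (0 : ℝ) ≤ (N : ℝ) + 1 := by positivity
    nlinarith
  rw [tsum_latticeSamples_eq_sum_Icc hB₀ hsupp hstep hN']

end Box

/-! ### §5. After the density factor: the coprime-restricted `s`-sum of `levelPrincipal` -/

/-- The coprimality indicator passes inside `levelPrincipal` (linearity in the level weights). [folklore] -/
theorem ite_levelPrincipal_eq (G : Finset ℕ) (P : Prop) [Decidable P] (F : ℕ → ℂ) (n : ℕ) :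
    (if P then levelPrincipal G F n else 0) = levelPrincipal G (fun q ↦ if P then F q else 0) n := by
  classical
  by_cases hP : P
  · simp only [if_pos hP]
  · simp only [if_neg hP, levelPrincipal, levelCoprimeSum, Finset.sum_const_zero, mul_zero]

open Classical in
/-- **The coprime-restricted `s`-sum of the principal parts.** For a finite set of levels `G`, box weights `Φ_q`
(smooth, compact support), `h ≠ 0`, frequencies `ξ₁ q`, shifts `τ q` and any bookkeeping modulus `n`:
`Σ'_{s, (s,h)=1} levelPrincipal G (q ↦ Φ̂_q(ξ₁ q, s/h + τ q)) n
   = φ(n)⁻¹·Σ_{q∈G, q unit mod n} Σ_{e∣|h|} μ(e)·(|h|/e)·Σ'_{k} e(−τ_q(|h|/e)k)·𝓕(t₁ ↦ Φ_q(t₁,(|h|/e)k))(ξ₁ q)`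
— the shape of `coreP` at a dual modulus `h₁` with `h = h₁/g₀`, `n = n₀ = |h|`, once the empty classes are routed to zero.
[folklore] -/
theorem tsum_coprime_levelPrincipal_eq (G : Finset ℕ) (Φ : ℕ → ℝ → ℝ → ℂ)
    (hΦ : ∀ q ∈ G, ContDiff ℝ ∞ (Function.uncurry (Φ q)))
    (hΦc : ∀ q ∈ G, HasCompactSupport (Function.uncurry (Φ q)))
    {h : ℤ} (hh : h ≠ 0) (ξ₁ τ : ℕ → ℝ) (n : ℕ) :
    ∑' s : ℤ, (if IsCoprime s h then
        levelPrincipal G (fun q ↦ fourier2 (Φ q) (ξ₁ q) ((s : ℝ) / h + τ q)) n else 0) =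
      (Nat.totient n : ℂ)⁻¹ * ∑ q ∈ G.filter (fun q : ℕ ↦ IsUnit ((q : ℕ) : ZMod n)),
        ∑ e ∈ h.natAbs.divisors, (μ e : ℂ) * (((h.natAbs / e : ℕ) : ℂ) *
          ∑' k : ℤ, (𝐞 (-(τ q * ((h.natAbs / e : ℕ) * k))) : ℂ) *
            𝓕 (fun t₁ : ℝ ↦ Φ q t₁ ((h.natAbs / e : ℕ) * k)) (ξ₁ q)) := by
  simp_rw [ite_levelPrincipal_eq]
  simp only [levelPrincipal, levelCoprimeSum]
  rw [tsum_mul_left]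
  congr 1
  have hG' : ∀ q ∈ G.filter (fun q : ℕ ↦ IsUnit ((q : ℕ) : ZMod n)), q ∈ G :=
    fun q hq ↦ (Finset.mem_filter.mp hq).1
  rw [Summable.tsum_finsetSum]
  · refine Finset.sum_congr rfl fun q hq ↦ ?_
    exact tsum_coprime_fourier2_intShift_eq (hΦ q (hG' q hq)) (hΦc q (hG' q hq)) hh (τ q) (ξ₁ q)
  · intro q hq
    refine ((summable_fourier2_intShift (hΦ q (hG' q hq)) (hΦc q (hG' q hq)) hh (τ q) (ξ₁ q)).indicator
      {s : ℤ | IsCoprime s h}).congr fun s ↦ ?_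
    simp only [Set.indicator_apply, Set.mem_setOf_eq]

end Summit.Parity.GeneralizedHardyLittlewood.Theorems.BeyondDiagonalBeatsQuarter.OffDiag
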